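import Literature.NumberTheory.Rogawski1990.SingularObsHasseArch
import Literature.NumberTheory.Rogawski1990.SingularFramePrescribedSignature
import HarnessLib

/-!
# Towards the singular ObsHasse: the archimedean invariants of the adelic conjugator as DATA for the prescribed-signature realisation
# (Rogawski 1990, §3.3 Prop. 3.3.1 p. 22, §3.8 Prop. 3.8.1 (d) p. 30; Kottwitz 1986 §7, §9)

Topic `NumberTheory/Rogawski1990`; namespace `Literature.NumberTheory.Rogawski1990`; **THEOREMS ONLY** (no definition, no named fact, no instance, no
notation, no `sorry`).  Cell `pub/hodgecm-mathlib`, ENGINE T1 (crux H413 = `stmt-HodgeConjecture-24833`), row O7 «singular semisimple classes»: piece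
**(h5-sign)** (F0P5a-p03 TRUNK WORDS #11) — the sibling of ★ (h5-arch) `SingularObsHasseArch` that turns the adelic conjugator `g` and the block-determinant
class into the INPUTS `p hp hsign htot` of ★ B-p12 (R6a-s′) `exists_commute_hermStar_eq_of_frame_of_signature_clause5` (at `ξ := k`).  HC_CM is proved only
modulo the printed citations until rung 0 closes.

THE MATHEMATICS.  Frame `ᵗ(σP) H P = H_a ⊕ᶠ H_b`, `γ₀ P = P (a·1₂ ⊕ᶠ b·1₁)` (`a ≠ b`); matching adèle `p` with conjugator `g`; `adelicBlockDet γ₀ a b g =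
(k ⊗ 1) · σ_𝔸(z) z`, `k ≠ 0`.  At `∞` (`π_∞`, `σ_∞ = c ⊗ 1`, letters made opaque as in ★ (h5-arch)) the form `(H_g)_∞` is block diagonal in the frame,
`(H_a)_∞ y₁ ⊕ᶠ (H_b)_∞ y₂` (★ `exists_twistGram_frame_eq_finSum`), with `det y₁ = (k⊗1)_∞ σ_∞(z_∞) z_∞` (★ `blockDet_lagrangeIdem_eq_det` + `blockDet_map`) and
`det y₂ · (k⊗1)_∞ σ_∞(z_∞) z_∞ = σ_∞(det g_∞) det g_∞` (★ `det_adelicCartan`).  DEFINE `p(w) :=` the positive index of the plane block `((H_a)_∞ y₁)_w`.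
Then (i) `p(w) ≤ 2`; (ii) PARITY: `det((H_a)_∞ y₁)_w = w(k det H_a) · |z_w|²`, so `0 < Re τ(k det H_a) ↔ #neg((H_a)_∞y₁)_w` even (★
`re_det_pos_iff_even_card_neg_eigenvalues`) `↔ 2 − p(w_τ)` even; (iii) TOTAL: `#pos τ(H) = #pos (H_g)_w` (Sylvester along `g_w`) `= #pos((H_a)_∞y₁)_w +
#pos((H_b)_∞y₂)_w` (Sylvester along `P_w`, additivity ★ `card_eigenvalues_finSum_eq_add`) and the line block reads `[0 < Re (w((H_b)₀₀) · (y₂)_w)] =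
[0 < Re w(k⁻¹ (H_b)₀₀)]` because `(y₂)_w = |det g_w|² ∕ (w(k) |z_w|²)` (★ `card_pos_eigenvalues_fin_one`).  Throughout, `τ : L →+* ℂ` is compared with the
embedding of its place `w_τ` (`= τ` or `τ̄`): positive indices (`τ̄(M) = τ(M)ᵀ`, same characteristic polynomial) and real parts do not see the conjugation.

* §1 **`MatchingAdeleG₂.exists_archSignature_of_adelicBlockDet_eq`** `(hH hHd) (hab) {P Ha Hb} (hP hγP) {k} (hk0) (p g hg) {z} (hδ) :
  ∃ p, (∀ w, p w ≤ 2) ∧ (∀ τ, 0 < Re τ(k det H_a) ↔ Even (2 − p (mk τ))) ∧ ∀ τ h₁, #pos τ(H) = p (mk τ) + [0 < Re τ(k⁻¹ (H_b)₀₀)]` — `htot` in the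
  `if`-letters of ★ `…_clause5`.  (No `σ k = k`, no hermitian-ness or non-degeneracy of the blocks is needed: the sign is read, not assumed.)
  One declaration carries the whole archimedean bookkeeping, hence `maxHeartbeats 400000` (2× default) on it.

## References
* [Rogawski1990] J. D. Rogawski, *Automorphic Representations of Unitary Groups in Three Variables*, Ann. of Math. Stud. 123 (1990), §3.3 Prop. 3.3.1 p. 22,
  §3.8 Prop. 3.8.1 (d) p. 30.
* [Kottwitz1986] R. E. Kottwitz, *Stable trace formula: elliptic singular terms*, Math. Ann. 275 (1986), §7 Prop. 7.1, §9.
* [BorelJacquet1979] A. Borel, H. Jacquet, PSPM 33.1 (1979), §4.1.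
* [Landherr1936HermitianForms] W. Landherr, Abh. Math. Sem. Hamburg 11 (1936) 245–248.
-/

set_option autoImplicit false

noncomputable section

open NumberField IsDedekindDomain
open scoped Matrix MatrixGroups ComplexConjugate ComplexOrder

namespace Literature.NumberTheory.Rogawski1990

open Literature.NumberTheory.Automorphic Literature.NumberTheory.Automorphic.UnitaryGroup
open Literature.AlgebraicGeometry.ShimuraVarieties (unitaryGroup)

section ArchSign

variable {L : Type} [Field L] [NumberField L] [IsCMField L] {H : Matrix (Fin 3) (Fin 3) L} {γ₀ : (UnitaryGroup.cmDatum L 3 H).Rational}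

/-- `(A ⊕ᶠ B)(C ⊕ᶠ D) = AC ⊕ᶠ BD`. [folklore] -/
private theorem finSum_mul_finSum₂ {S : Type*} [CommRing S] {N₁ N₂ : ℕ} (A C : Matrix (Fin N₁) (Fin N₁) S) (B D : Matrix (Fin N₂) (Fin N₂) S) :
    finSum N₁ N₂ A B * finSum N₁ N₂ C D = finSum N₁ N₂ (A * C) (B * D) := by
  simp only [finSum, Matrix.reindex_apply, Matrix.submatrix_mul_equiv, Matrix.fromBlocks_multiply, Matrix.mul_zero, Matrix.zero_mul,
    add_zero, zero_add]

/-- `det (A ⊕ᶠ B) = det A · det B`. [folklore] -/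
private theorem det_finSum₂ {S : Type*} [CommRing S] {N₁ N₂ : ℕ} (A : Matrix (Fin N₁) (Fin N₁) S) (B : Matrix (Fin N₂) (Fin N₂) S) :
    (finSum N₁ N₂ A B).det = A.det * B.det := by
  rw [finSum, Matrix.det_reindex_self, Matrix.det_fromBlocks_zero₂₁]

/-- `⊕ᶠ` is injective in the pair of blocks. [folklore] -/
private theorem finSum_injective_pair₂ {S : Type*} [CommRing S] {N₁ N₂ : ℕ} {A C : Matrix (Fin N₁) (Fin N₁) S} {B D : Matrix (Fin N₂) (Fin N₂) S}
    (h : finSum N₁ N₂ A B = finSum N₁ N₂ C D) : A = C ∧ B = D := by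
  have h' := (Matrix.reindex finSumFinEquiv finSumFinEquiv).injective h
  rw [Matrix.fromBlocks_inj] at h'
  exact ⟨h'.1, h'.2.2.2⟩

/-- Positive-index counts of equal hermitian matrices agree (transport along `X = A`). [folklore] -/
private theorem card_pos_eigenvalues_congr₂ {n : Type} [Fintype n] [DecidableEq n] {X A : Matrix n n ℂ} (h : X = A) (hX : X.IsHermitian)
    (hA : A.IsHermitian) :
    (Finset.univ.filter fun i => 0 < hX.eigenvalues i).card = (Finset.univ.filter fun i => 0 < hA.eigenvalues i).card := by
  subst h
  rfl

/-- The positive index of a hermitian matrix is that of its transpose (same characteristic polynomial). [folklore] -/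
private theorem card_pos_eigenvalues_transpose {n : Type} [Fintype n] [DecidableEq n] {A : Matrix n n ℂ} (hA : A.IsHermitian) (hT : Aᵀ.IsHermitian) :
    (Finset.univ.filter fun i => 0 < hT.eigenvalues i).card = (Finset.univ.filter fun i => 0 < hA.eigenvalues i).card := by
  have key : ∀ {B : Matrix n n ℂ} (hB : B.IsHermitian),
      (Finset.univ.filter fun i => 0 < hB.eigenvalues i).card = B.charpoly.roots.countP (fun z => 0 < RCLike.re z) := by
    intro B hB
    rw [hB.roots_charpoly_eq_eigenvalues, Multiset.countP_map, Finset.card_def, Finset.filter_val]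
    congr 1
  rw [key hT, key hA, Matrix.charpoly_transpose]

omit [NumberField L] [IsCMField L] in
/-- **Signatures do not see complex conjugation of the embedding**: for a `σ`-hermitian `M` over `L` and `τ : L →+* ℂ`, the positive index of
`τ̄(M) = τ(M)ᵀ` is that of `τ(M)`. [cite: Landherr1936HermitianForms] -/
private theorem card_pos_eigenvalues_map_conjugate {n : Type} [Fintype n] [DecidableEq n] {M : Matrix n n L} {τ : L →+* ℂ}
    (h₁ : (M.map τ).IsHermitian) (h₂ : (M.map (ComplexEmbedding.conjugate τ)).IsHermitian) :
    (Finset.univ.filter fun i => 0 < h₂.eigenvalues i).card = (Finset.univ.filter fun i => 0 < h₁.eigenvalues i).card := by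
  have hMT : M.map (ComplexEmbedding.conjugate τ) = (M.map τ)ᵀ := by
    have e : M.map (ComplexEmbedding.conjugate τ) = (M.map τ).map (starRingEnd ℂ) := by
      rw [Matrix.map_map]; rfl
    rw [e]
    have hc : ((M.map τ).map (starRingEnd ℂ))ᵀ = M.map τ := h₁.eq
    have := congrArg Matrix.transpose hc
    rwa [Matrix.transpose_transpose] at this
  have hT : ((M.map τ)ᵀ).IsHermitian := hMT ▸ h₂
  rw [card_pos_eigenvalues_congr₂ hMT h₂ hT, card_pos_eigenvalues_transpose h₁ hT]

/-- The real sign bookkeeping of the `1 × 1` block: if `Y · (K · (ŪU)) = D̄D` with `K, U, D ≠ 0`, then `Re (B·Y) > 0 ↔ Re (K⁻¹ B) > 0`. [folklore] -/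
private theorem re_mul_pos_iff_of_mul_eq {K B Y D U : ℂ} (hK0 : K ≠ 0) (hU : U ≠ 0) (hD : D ≠ 0)
    (hY : Y * (K * (starRingEnd ℂ U * U)) = starRingEnd ℂ D * D) : 0 < (B * Y).re ↔ 0 < (K⁻¹ * B).re := by
  have hU2 : (0 : ℝ) < Complex.normSq U := Complex.normSq_pos.mpr hU
  have hD2 : (0 : ℝ) < Complex.normSq D := Complex.normSq_pos.mpr hD
  rw [← Complex.normSq_eq_conj_mul_self, ← Complex.normSq_eq_conj_mul_self] at hY
  have hKU : K * (Complex.normSq U : ℂ) ≠ 0 := mul_ne_zero hK0 (by exact_mod_cast hU2.ne')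
  have hY' : Y = (Complex.normSq D : ℂ) / (K * (Complex.normSq U : ℂ)) := by rw [← hY, mul_div_cancel_right₀ _ hKU]
  have hBY : B * Y = K⁻¹ * B * ((Complex.normSq D / Complex.normSq U : ℝ) : ℂ) := by
    rw [hY']
    have hU0 : (Complex.normSq U : ℂ) ≠ 0 := by exact_mod_cast hU2.ne'
    push_cast
    field_simp
  rw [hBY, Complex.re_mul_ofReal]
  exact mul_pos_iff_of_pos_right (div_pos hD2 hU2)

set_option maxHeartbeats 400000 in -- one long archimedean bookkeeping proof (frame, determinants, two signatures); 2× default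
/-- **(h5-sign) THE ARCHIMEDEAN INVARIANTS OF THE ADELIC CONJUGATOR, AS DATA FOR ★ (R6a-s′).**  Frame and block-determinant class as in ★ (h5-fin)∕(h5-arch)
(`ᵗ(σP) H P = H_a ⊕ᶠ H_b`, `γ₀ P = P(a·1₂ ⊕ᶠ b·1₁)`, `a ≠ b`; matching adèle `p`, conjugator `g`, `adelicBlockDet γ₀ a b g = (k ⊗ 1) · σ_𝔸(z) z`, `k ≠ 0`).
Let `p(w)` be the positive index of the PLANE BLOCK `(H_a)_∞ y₁` of the framed archimedean form `(H_g)_∞` at the complex place `w` (★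
`exists_twistGram_frame_eq_finSum` at `L ⊗ ℝ`).  Then: `p(w) ≤ 2`; **parity** `0 < Re τ(k · det H_a) ↔ 2 − p(w_τ)` even at every `τ : L →+* ℂ`
(`det y₁ = (k ⊗ 1)_∞ σ_∞(z_∞) z_∞` by the ★ bridge `blockDet_lagrangeIdem_eq_det`, so `det((H_a)_∞y₁)_w = τ(k det H_a)·|z_w|²`, and ★
`re_det_pos_iff_even_card_neg_eigenvalues`); **total** `#pos τ(H) = p(w_τ) + [0 < Re τ(k⁻¹ (H_b)₀₀)]` (Sylvester along `g_w` and `P_w` ★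
`Landherr.card_pos_eigenvalues_eq_of_congr`, additivity ★ `card_eigenvalues_finSum_eq_add`, and the line block `(H_b)_w (y₂)_w` with
`(y₂)_w · k_w |z_w|² = |det g_w|²` from `det x_g = N(det g)` ★ `det_adelicCartan`, read by ★ `card_pos_eigenvalues_fin_one`; `τ` versus `w_τ.embedding = τ` or
`τ̄`: signatures and real parts do not see the conjugation).  These are exactly the inputs `p hp hsign htot` of ★ B-p12
`exists_commute_hermStar_eq_of_frame_of_signature_clause5` at `ξ := k`. [cite: Rogawski1990, §3.8 Prop. 3.8.1 (d) p. 30; §3.3 (3.3.1) p. 22]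
[cite: Kottwitz1986, §7, §9] [cite: BorelJacquet1979, §4.1] -/
theorem MatchingAdeleG₂.exists_archSignature_of_adelicBlockDet_eq (hH : (H.map (cmConjRingHom L))ᵀ = H) (hHd : H.det ≠ 0) {a b : L} (hab : a ≠ b)
    {P : GL (Fin 3) L} {Ha : Matrix (Fin 2) (Fin 2) L} {Hb : Matrix (Fin 1) (Fin 1) L}
    (hP : (((P : Matrix (Fin 3) (Fin 3) L)).map (cmConjRingHom L))ᵀ * H * (P : Matrix (Fin 3) (Fin 3) L) = finSum 2 1 Ha Hb)
    (hγP : (((γ₀ : unitaryGroup (cmConjRingHom L) H).val : GL (Fin 3) L) : Matrix (Fin 3) (Fin 3) L) * (P : Matrix (Fin 3) (Fin 3) L) =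
      (P : Matrix (Fin 3) (Fin 3) L) * finSum 2 1 (a • (1 : Matrix (Fin 2) (Fin 2) L)) (b • (1 : Matrix (Fin 1) (Fin 1) L)))
    {k : L} (hk0 : k ≠ 0)
    (p : MatchingAdeleG₂ L H H γ₀) (g : GL (Fin 3) (AdeleRing (𝓞 L) L))
    (hg : g * (((UnitaryGroup.cmDatum L 3 H).toAdelic γ₀).val : GL (Fin 3) (AdeleRing (𝓞 L) L)) * g⁻¹ = (p.adele.val : GL (Fin 3) (AdeleRing (𝓞 L) L)))
    {z : (AdeleRing (𝓞 L) L)ˣ}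
    (hδ : adelicBlockDet γ₀ a b g = algebraMap L (AdeleRing (𝓞 L) L) k * (adeleConj L (z : AdeleRing (𝓞 L) L) * (z : AdeleRing (𝓞 L) L))) :
    ∃ q : InfinitePlace L → ℕ, (∀ w, q w ≤ 2) ∧
      (∀ τ : L →+* ℂ, 0 < (τ (k * Ha.det)).re ↔ Even (2 - q (InfinitePlace.mk τ))) ∧
      ∀ (τ : L →+* ℂ) (h₁ : (H.map τ).IsHermitian),
        (Finset.univ.filter fun i => 0 < h₁.eigenvalues i).card = q (InfinitePlace.mk τ) + (if 0 < (τ (k⁻¹ * Hb 0 0)).re then 1 else 0) := by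
  -- LETTERS at `∞` (as in ★ (h5-arch))
  set 𝔸 := AdeleRing (𝓞 L) L with h𝔸
  set πv : 𝔸 →+* NumberField.mixedEmbedding.mixedSpace L := (InfiniteAdeleRing.ringEquiv_mixedSpace L).toRingHom.comp (UnitaryGroup.adeleFst L)
    with hπv
  set σv := UnitaryGroup.conjMixed (↥(maximalRealSubfield L)) L (IsCMField.complexConj L) with hσv
  set F : L →+* NumberField.mixedEmbedding.mixedSpace L := πv.comp (algebraMap L 𝔸) with hFdef
  have hπσ : ∀ x : 𝔸, πv (adeleConj L x) = σv (πv x) := fun x => by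
    simp only [hπv, RingHom.coe_comp, RingEquiv.toRingHom_eq_coe, RingHom.coe_coe, Function.comp_apply]
    exact QuadraticForms.ringEquiv_mixedSpace_fst_adeleConj L x
  have hFx : ∀ x : L, F x = NumberField.mixedEmbedding L x := fun x => by
    show πv (algebraMap L 𝔸 x) = _
    simp only [hπv, RingHom.coe_comp, RingEquiv.toRingHom_eq_coe, RingHom.coe_coe, Function.comp_apply]
    exact QuadraticForms.ringEquiv_mixedSpace_fst_algebraMap L x
  have hF : ∀ r : L, F (cmConjRingHom L r) = σv (F r) := fun r => by
    show πv (algebraMap L 𝔸 (cmConjRingHom L r)) = σv (πv (algebraMap L 𝔸 r))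
    rw [← adeleConj_algebraMap, hπσ]
  have hc1 : IsCMField.complexConj L ≠ 1 := IsCMField.complexConj_ne_one L
  have hfix : ∀ w : InfinitePlace L, IsCMField.complexConj L • w = w := UnitaryGroup.complexConj_smul_infinitePlace L
  have hσσv : ∀ x, σv (σv x) = x := conjMixed_conjMixed_apply _ L _ hc1 hfix
  -- `F` read at a complex place is the embedding of the place
  have hFw : ∀ (w : {w : InfinitePlace L // w.IsComplex}) (x : L), UnitaryGroup.evalC L w (F x) = w.1.embedding x := fun w x => by
    rw [hFx, UnitaryGroup.evalC_apply, NumberField.mixedEmbedding.mixedEmbedding_apply_isComplex]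
  have hFmw : ∀ (w : {w : InfinitePlace L // w.IsComplex}) {m n : ℕ} (M : Matrix (Fin m) (Fin n) L),
      (M.map F).map (UnitaryGroup.evalC L w) = M.map w.1.embedding := by
    intro w m n M
    rw [Matrix.map_map]
    exact Matrix.ext fun i j => hFw w (M i j)
  clear_value F πv
  -- names for the mapped objects
  set Hv : Matrix (Fin 3) (Fin 3) (NumberField.mixedEmbedding.mixedSpace L) := (H.map (algebraMap L 𝔸)).map πv with hHv
  have hHvF : Hv = H.map F := by rw [hHv, hFdef, RingHom.coe_comp, ← Matrix.map_map]
  set Pv : GL (Fin 3) (NumberField.mixedEmbedding.mixedSpace L) := Matrix.GeneralLinearGroup.map F P with hPvdef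
  have hPv : Pv.val = (P : Matrix (Fin 3) (Fin 3) L).map F := rfl
  set γ𝔸 : GL (Fin 3) 𝔸 := ((UnitaryGroup.cmDatum L 3 H).toAdelic γ₀).val with hγ𝔸
  have hγ𝔸val : (γ𝔸 : Matrix (Fin 3) (Fin 3) 𝔸) = ((((γ₀ : unitaryGroup (cmConjRingHom L) H).val : GL (Fin 3) L) : Matrix (Fin 3) (Fin 3) L)).map
      (algebraMap L 𝔸) := by
    rw [hγ𝔸, UnitaryGroup.coe_cmDatum_toAdelic, val_toAdeleGL]
  set γv : Matrix (Fin 3) (Fin 3) (NumberField.mixedEmbedding.mixedSpace L) := (γ𝔸 : Matrix (Fin 3) (Fin 3) 𝔸).map πv with hγvdef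
  have hγvF : γv = ((((γ₀ : unitaryGroup (cmConjRingHom L) H).val : GL (Fin 3) L) : Matrix (Fin 3) (Fin 3) L)).map F := by
    rw [hγvdef, hγ𝔸val, hFdef, RingHom.coe_comp, ← Matrix.map_map]
  set xg : Matrix (Fin 3) (Fin 3) 𝔸 := (H.map (algebraMap L 𝔸))⁻¹ * twistGram (adeleConj L) (H.map (algebraMap L 𝔸)) (g : Matrix (Fin 3) (Fin 3) 𝔸) with hxg
  set xv : Matrix (Fin 3) (Fin 3) (NumberField.mixedEmbedding.mixedSpace L) := xg.map πv with hxvdef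
  -- unit determinants
  have hHu : IsUnit H.det := isUnit_iff_ne_zero.mpr hHd
  have hHvd : IsUnit Hv.det := by rw [hHvF, ← RingHom.mapMatrix_apply, ← RingHom.map_det]; exact hHu.map F
  have hFab : IsUnit (F a - F b) := by rw [← map_sub]; exact (IsUnit.mk0 _ (sub_ne_zero.mpr hab)).map F
  -- (1) the frame at `∞`
  have hPv_frame : twistGram σv Hv Pv.val = finSum 2 1 (Ha.map F) (Hb.map F) := by
    rw [hHvF, hPv, ← twistGram_map (cmConjRingHom L) H σv F hF, twistGram_def, hP, finSum_map]
  have hsmul1 : ∀ (n : ℕ) (c : L), (c • (1 : Matrix (Fin n) (Fin n) L)).map F = F c • (1 : Matrix (Fin n) (Fin n) (NumberField.mixedEmbedding.mixedSpace L)) :=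
    fun n c => by rw [Matrix.map_smul' _ _ _ (map_mul F), Matrix.map_one _ (map_zero F) (map_one F)]
  have hγv_frame : γv * Pv.val =
      Pv.val *
        finSum 2 1 (F a • (1 : Matrix (Fin 2) (Fin 2) (NumberField.mixedEmbedding.mixedSpace L)))
          (F b • (1 : Matrix (Fin 1) (Fin 1) (NumberField.mixedEmbedding.mixedSpace L))) := by
    rw [hγvF, hPv, ← Matrix.map_mul, hγP, Matrix.map_mul, finSum_map, hsmul1, hsmul1]
  -- (2) the transported form `G' = (H_g)_∞`, hermitian with unit determinant
  set G' : Matrix (Fin 3) (Fin 3) (NumberField.mixedEmbedding.mixedSpace L) := twistGram σv Hv ((g : Matrix (Fin 3) (Fin 3) 𝔸).map πv) with hG'def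
  have hσF : (⇑σv ∘ ⇑F : L → NumberField.mixedEmbedding.mixedSpace L) = ⇑F ∘ ⇑(cmConjRingHom L) := funext fun r => (hF r).symm
  have hσvHv : (Hv.map σv)ᵀ = Hv := by
    rw [hHvF, Matrix.map_map, hσF, ← Matrix.map_map, ← Matrix.transpose_map, hH]
  have hG' : (G'.map σv)ᵀ = G' := conjTranspose_twistGram σv Hv hσσv hσvHv _
  have hgvd : IsUnit ((g : Matrix (Fin 3) (Fin 3) 𝔸).map πv).det := by
    rw [← RingHom.mapMatrix_apply, ← RingHom.map_det]; exact (Matrix.isUnits_det_units g).map πv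
  -- (3) the frame of `G'`
  have hxv_eq : xv = Hv⁻¹ * G' := by
    rw [hxvdef, hxg, hG'def, hHv, hπv]; exact map_arch_inv_mul_twistGram hHd _
  have hxv_comm : Hv⁻¹ * G' * γv = γv * (Hv⁻¹ * G') := by
    rw [← hxv_eq, hxvdef, hγvdef, ← Matrix.map_mul, ← Matrix.map_mul]
    exact congrArg (fun M : Matrix (Fin 3) (Fin 3) 𝔸 => M.map ⇑πv) (commute_adelicCartan hHu p hg).eq
  obtain ⟨y₁, y₂, hG'P⟩ := exists_twistGram_frame_eq_finSum (N₁ := 2) (N₂ := 1) σv hHvd hFab hPv_frame hγv_frame hxv_comm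
  change Matrix (Fin 2) (Fin 2) (NumberField.mixedEmbedding.mixedSpace L) at y₁
  change twistGram σv G' Pv.val = finSum 2 1 (Ha.map F * y₁) (Hb.map F * y₂) at hG'P
  -- the blocks of `G'` are hermitian
  have hPG' : ((twistGram σv G' Pv.val).map σv)ᵀ = twistGram σv G' Pv.val := conjTranspose_twistGram σv G' hσσv hG' _
  rw [hG'P, transpose_finSum_map] at hPG'
  obtain ⟨hb₁, hb₂⟩ := finSum_injective_pair₂ hPG'
  have herm : ∀ {m : ℕ} {X : Matrix (Fin m) (Fin m) (NumberField.mixedEmbedding.mixedSpace L)}, (X.map σv)ᵀ = X →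
      ∀ w : {w : InfinitePlace L // w.IsComplex}, (X.map (UnitaryGroup.evalC L w)).IsHermitian :=
    fun hX w => isHermitian_map_evalC_of_transpose_map_conjMixed _ L _ hc1 hfix hX w
  -- (4) `x_∞` in the frame; the determinants of `y₁`, `y₂`
  have hPu : IsUnit Pv.val.det := by
    rw [hPv, ← RingHom.mapMatrix_apply, ← RingHom.map_det]; exact (Matrix.isUnits_det_units P).map F
  have hxvP : xv * Pv.val = Pv.val * finSum 2 1 y₁ y₂ := by
    have hfu : IsUnit (finSum 2 1 (Ha.map F) (Hb.map F)).det := by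
      rw [← hPv_frame, det_twistGram]; exact ((hPu.map σv).mul hHvd).mul hPu
    have h1 : finSum 2 1 (Ha.map F) (Hb.map F) * (Pv.val⁻¹ * xv * Pv.val) = finSum 2 1 (Ha.map F) (Hb.map F) * finSum 2 1 y₁ y₂ := by
      rw [finSum_mul_finSum₂, ← hG'P, ← hPv_frame, twistGram_def, twistGram_def, hxv_eq]
      simp only [Matrix.mul_assoc]
      rw [Matrix.mul_nonsing_inv_cancel_left _ _ hPu, Matrix.mul_nonsing_inv_cancel_left _ _ hHvd]
    have h2 : Pv.val⁻¹ * xv * Pv.val = finSum 2 1 y₁ y₂ := by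
      have h := congrArg (fun M => (finSum 2 1 (Ha.map F) (Hb.map F))⁻¹ * M) h1
      simpa only [← Matrix.mul_assoc, Matrix.nonsing_inv_mul _ hfu, Matrix.one_mul] using h
    rw [← h2, ← Matrix.mul_assoc, ← Matrix.mul_assoc, Matrix.mul_nonsing_inv _ hPu, Matrix.one_mul]
  have hev : (adelicLagrangeIdem γ₀ a b).map ⇑πv = F (a - b)⁻¹ • (γv - F b • (1 : Matrix (Fin 3) (Fin 3) (NumberField.mixedEmbedding.mixedSpace L))) := by
    rw [adelicLagrangeIdem_eq, Matrix.map_smul' _ _ _ (map_mul πv), Matrix.map_sub _ (map_sub πv), Matrix.map_smul' _ _ _ (map_mul πv),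
      Matrix.map_one _ (map_zero πv) (map_one πv), hγvdef, hγ𝔸, hFdef, RingHom.comp_apply, RingHom.comp_apply]
  have hu : F (a - b)⁻¹ * (F a - F b) = 1 := by
    rw [← map_sub, ← map_mul, inv_mul_cancel₀ (sub_ne_zero.2 hab), map_one]
  have hdet₁' : y₁.det = F k * (σv (πv (z : 𝔸)) * πv (z : 𝔸)) := by
    rw [← blockDet_lagrangeIdem_eq_det (N₁ := 2) (N₂ := 1) (P := Pv) hγv_frame hu hxvP, ← hev, hxvdef, hxg, blockDet_map, ← adelicBlockDet_def, hδ, map_mul, map_mul,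
      hπσ, hFdef, RingHom.comp_apply]
  have hxgdet : xv.det = σv (πv (g : Matrix (Fin 3) (Fin 3) 𝔸).det) * πv (g : Matrix (Fin 3) (Fin 3) 𝔸).det := by
    rw [hxvdef, ← RingHom.mapMatrix_apply, ← RingHom.map_det, hxg, det_adelicCartan hHu, map_mul, hπσ]
  have hdet₂' : y₂.det * (F k * (σv (πv (z : 𝔸)) * πv (z : 𝔸))) = σv (πv (g : Matrix (Fin 3) (Fin 3) 𝔸).det) * πv (g : Matrix (Fin 3) (Fin 3) 𝔸).det := by
    have hfin : finSum 2 1 y₁ y₂ = Pv.val⁻¹ * xv * Pv.val := by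
      rw [Matrix.mul_assoc, hxvP, ← Matrix.mul_assoc, Matrix.nonsing_inv_mul _ hPu, Matrix.one_mul]
    have h := congrArg Matrix.det hfin
    rw [det_finSum₂, Matrix.det_conj' Pv.isUnit, hxgdet, hdet₁'] at h
    rw [mul_comm]
    exact h
  -- determinant facts used at every place
  have hHad : IsUnit (Ha.map F).det := by
    have hfu : IsUnit (finSum 2 1 (Ha.map F) (Hb.map F)).det := by
      rw [← hPv_frame, det_twistGram]; exact ((hPu.map σv).mul hHvd).mul hPu
    rw [det_finSum₂] at hfu
    exact isUnit_of_mul_isUnit_left hfu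
  have hzu : IsUnit (σv (πv (z : 𝔸)) * πv (z : 𝔸)) := (((Units.isUnit z).map πv).map σv).mul ((Units.isUnit z).map πv)
  have hy₁u : IsUnit y₁.det := by rw [hdet₁']; exact ((IsUnit.mk0 _ hk0).map F).mul hzu
  have hA : (Ha.map F * y₁).det = F (k * Ha.det) * (σv (πv (z : 𝔸)) * πv (z : 𝔸)) := by
    rw [Matrix.det_mul, hdet₁', ← RingHom.mapMatrix_apply, ← RingHom.map_det, map_mul]; ring
  have hAu : IsUnit (Ha.map F * y₁).det := by rw [Matrix.det_mul]; exact hHad.mul hy₁u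
  -- readings at a complex place `w`
  have hσz : ∀ w : {w : InfinitePlace L // w.IsComplex},
      UnitaryGroup.evalC L w (σv (πv (z : 𝔸))) = starRingEnd ℂ (UnitaryGroup.evalC L w (πv (z : 𝔸))) :=
    fun w => UnitaryGroup.evalC_conjMixed _ L _ (hfix w.1) hc1 _
  have hz0 : ∀ w : {w : InfinitePlace L // w.IsComplex}, UnitaryGroup.evalC L w (πv (z : 𝔸)) ≠ 0 :=
    fun w => ((((Units.isUnit z).map πv).map (UnitaryGroup.evalC L w)).ne_zero :)
  have hdetw : ∀ w : {w : InfinitePlace L // w.IsComplex}, ((Ha.map F * y₁).map (UnitaryGroup.evalC L w)).det =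
      w.1.embedding (k * Ha.det) * ((Complex.normSq (UnitaryGroup.evalC L w (πv (z : 𝔸))) : ℝ) : ℂ) := fun w => by
    rw [← RingHom.mapMatrix_apply, ← RingHom.map_det, hA, map_mul (UnitaryGroup.evalC L w), map_mul (UnitaryGroup.evalC L w), hFw, hσz,
      ← Complex.normSq_eq_conj_mul_self]
  have hd0 : ∀ w : {w : InfinitePlace L // w.IsComplex}, ((Ha.map F * y₁).map (UnitaryGroup.evalC L w)).det ≠ 0 := fun w => by
    rw [← RingHom.mapMatrix_apply, ← RingHom.map_det]
    exact (hAu.map (UnitaryGroup.evalC L w)).ne_zero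
  -- every infinite place of the CM field `L` is complex; `τ` versus the embedding of the place `w_τ`
  have hallc : ∀ w : InfinitePlace L, w.IsComplex := fun w => UnitaryGroup.isComplex_of_smul_eq _ L _ hc1 (hfix w)
  have hwc : ∀ τ : L →+* ℂ, (InfinitePlace.mk τ).IsComplex := fun τ => hallc _
  have hre : ∀ (τ : L →+* ℂ) (x : L), (τ x).re = ((InfinitePlace.mk τ).embedding x).re := fun τ x => by
    rcases InfinitePlace.embedding_mk_eq τ with h | h
    · rw [h]
    · rw [h, ComplexEmbedding.conjugate_coe_eq, Complex.conj_re]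
  -- (5) the data: `q w :=` the positive index of the plane block `(H_a)_∞ y₁` at `w`
  refine ⟨fun w => (Finset.univ.filter fun i => 0 < (herm hb₁ ⟨w, hallc w⟩).eigenvalues i).card, fun w => ?_, fun τ => ?_, fun τ h₁ => ?_⟩
  · -- `q w ≤ 2`
    exact (Finset.card_filter_le _ _).trans (by rw [Finset.card_univ, Fintype.card_fin])
  · -- parity at `τ`: `0 < Re τ(k det H_a) ↔ 0 < Re det((H_a y₁)_w) ↔ #neg even ↔ 2 − #pos even`
    beta_reduce
    have hpos : 0 < Complex.normSq (UnitaryGroup.evalC L ⟨InfinitePlace.mk τ, hallc _⟩ (πv (z : 𝔸))) := Complex.normSq_pos.mpr (hz0 _)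
    have e := card_pos_add_card_neg_eigenvalues_eq_card (herm hb₁ ⟨InfinitePlace.mk τ, hallc _⟩) (hd0 ⟨InfinitePlace.mk τ, hallc _⟩)
    rw [Fintype.card_fin] at e
    have h1 : (0 < (τ (k * Ha.det)).re) ↔ 0 < ((Ha.map F * y₁).map (UnitaryGroup.evalC L ⟨InfinitePlace.mk τ, hallc _⟩)).det.re := by
      rw [hre, hdetw ⟨InfinitePlace.mk τ, hallc _⟩, Complex.re_mul_ofReal]
      exact (mul_pos_iff_of_pos_right hpos).symm
    have h2 := re_det_pos_iff_even_card_neg_eigenvalues (herm hb₁ ⟨InfinitePlace.mk τ, hallc _⟩) (hd0 ⟨InfinitePlace.mk τ, hallc _⟩)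
    have h3 : (Finset.univ.filter fun i => (herm hb₁ ⟨InfinitePlace.mk τ, hallc _⟩).eigenvalues i < 0).card =
        2 - (Finset.univ.filter fun i => 0 < (herm hb₁ ⟨InfinitePlace.mk τ, hallc _⟩).eigenvalues i).card := by omega
    rw [h3] at h2
    exact h1.trans h2
  · -- the total signature at `τ`
    beta_reduce
    set w : {w : InfinitePlace L // w.IsComplex} := ⟨InfinitePlace.mk τ, hallc _⟩ with hwdef
    -- pass from `τ` to the embedding of `w`
    have hHw : (H.map w.1.embedding).IsHermitian := by rw [← hFmw w H, ← hHvF]; exact herm hσvHv w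
    have hτw : (Finset.univ.filter fun i => 0 < h₁.eigenvalues i).card = (Finset.univ.filter fun i => 0 < hHw.eigenvalues i).card ∧
        (τ (k⁻¹ * Hb 0 0)).re = (w.1.embedding (k⁻¹ * Hb 0 0)).re := by
      refine ⟨?_, hre τ _⟩
      rcases InfinitePlace.embedding_mk_eq τ with h | h
      · have h' : w.1.embedding = τ := h
        exact card_pos_eigenvalues_congr₂ (by rw [h']) h₁ hHw
      · have h' : w.1.embedding = ComplexEmbedding.conjugate τ := h
        have h₂ : (H.map (ComplexEmbedding.conjugate τ)).IsHermitian := by rw [← h']; exact hHw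
        rw [← card_pos_eigenvalues_map_conjugate h₁ h₂]
        exact card_pos_eigenvalues_congr₂ (by rw [h']) h₂ hHw
    rw [hτw.1, hτw.2]
    -- `#pos H_w = #pos (G')_w` (congruent by `g_w`) `= #pos ((H_a y₁)_w ⊕ᶠ (H_b y₂)_w)` (congruent by `P_w`) `= #pos + #pos`
    have hG'w := herm hG' w
    have hgw : IsUnit (((g : Matrix (Fin 3) (Fin 3) 𝔸).map πv).map (UnitaryGroup.evalC L w)).det := by
      rw [← RingHom.mapMatrix_apply, ← RingHom.map_det]; exact hgvd.map _
    have e₁ : (Finset.univ.filter fun i => 0 < hHw.eigenvalues i).card = (Finset.univ.filter fun i => 0 < hG'w.eigenvalues i).card :=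
      QuadraticForms.Landherr.card_pos_eigenvalues_eq_of_congr hHw hG'w hgw (by
        rw [hG'def, twistGram_conjMixed_map_evalC _ L _ hc1 hfix, hHvF, hFmw w H])
    have hfinw : (finSum 2 1 ((Ha.map F * y₁).map (UnitaryGroup.evalC L w)) ((Hb.map F * y₂).map (UnitaryGroup.evalC L w))).IsHermitian := by
      rw [← finSum_map, ← hG'P]; exact herm (conjTranspose_twistGram σv G' hσσv hG' _) w
    have hPw : IsUnit ((Pv.val).map (UnitaryGroup.evalC L w)).det := by
      rw [← RingHom.mapMatrix_apply, ← RingHom.map_det]; exact hPu.map _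
    have e₂ : (Finset.univ.filter fun i => 0 < hG'w.eigenvalues i).card = (Finset.univ.filter fun i => 0 < hfinw.eigenvalues i).card :=
      QuadraticForms.Landherr.card_pos_eigenvalues_eq_of_congr hG'w hfinw hPw (by
        rw [← twistGram_conjMixed_map_evalC _ L _ hc1 hfix, hG'P, finSum_map])
    have e₃ := card_eigenvalues_finSum_eq_add (herm hb₁ w) (herm hb₂ w) hfinw (fun x => 0 < x)
    rw [e₁, e₂, e₃, card_pos_eigenvalues_fin_one (herm hb₂ w)]
    -- the line block: `((H_b)_w (y₂)_w)₀₀ = w.embedding((H_b)₀₀) · (y₂)_w`, and the sign of `(y₂)_w` is that of `k_w⁻¹`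
    congr 1
    have hBY : ((Hb.map F * y₂).map (UnitaryGroup.evalC L w)) 0 0 = w.1.embedding (Hb 0 0) * UnitaryGroup.evalC L w y₂.det := by
      rw [← Matrix.det_fin_one ((Hb.map F * y₂).map (UnitaryGroup.evalC L w)), ← RingHom.mapMatrix_apply, ← RingHom.map_det, Matrix.det_mul,
        map_mul]
      congr 1
      rw [← RingHom.mapMatrix_apply, ← RingHom.map_det, Matrix.det_fin_one, hFw]
    have hσD : UnitaryGroup.evalC L w (σv (πv (g : Matrix (Fin 3) (Fin 3) 𝔸).det)) =
        starRingEnd ℂ (UnitaryGroup.evalC L w (πv (g : Matrix (Fin 3) (Fin 3) 𝔸).det)) :=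
      UnitaryGroup.evalC_conjMixed _ L _ (hfix w.1) hc1 _
    have hD0 : UnitaryGroup.evalC L w (πv (g : Matrix (Fin 3) (Fin 3) 𝔸).det) ≠ 0 := by
      have h := (hgvd.map (UnitaryGroup.evalC L w)).ne_zero
      rw [← RingHom.mapMatrix_apply, ← RingHom.map_det] at h
      exact h
    have hK0 : w.1.embedding k ≠ 0 := (map_ne_zero w.1.embedding).mpr hk0
    have hY : UnitaryGroup.evalC L w y₂.det * (w.1.embedding k * (starRingEnd ℂ (UnitaryGroup.evalC L w (πv (z : 𝔸))) *
        UnitaryGroup.evalC L w (πv (z : 𝔸)))) =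
        starRingEnd ℂ (UnitaryGroup.evalC L w (πv (g : Matrix (Fin 3) (Fin 3) 𝔸).det)) * UnitaryGroup.evalC L w (πv (g : Matrix (Fin 3) (Fin 3) 𝔸).det) := by
      have h := congrArg (UnitaryGroup.evalC L w) hdet₂'
      rw [map_mul (UnitaryGroup.evalC L w), map_mul (UnitaryGroup.evalC L w), map_mul (UnitaryGroup.evalC L w),
        map_mul (UnitaryGroup.evalC L w), hFw, hσz, hσD] at h
      exact h
    have key := re_mul_pos_iff_of_mul_eq (B := w.1.embedding (Hb 0 0)) hK0 (hz0 w) hD0 hY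
    rw [hBY, map_mul (w.1.embedding), map_inv₀]
    by_cases hq : 0 < ((w.1.embedding k)⁻¹ * w.1.embedding (Hb 0 0)).re
    · rw [if_pos hq, if_pos (key.mpr hq)]
    · rw [if_neg hq, if_neg (fun h => hq (key.mp h))]

end ArchSign

end Literature.NumberTheory.Rogawski1990

end
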